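import Summits.BirchSwinnertonDyer.Rank1Residual.X12.CMRamifiedRecordSchemaG
import HarnessLib

/-!
# Leaf `CornerF ∧ CMRamified`, slice `p = 3`: PART G addendum — the bottom-index field `sV := #S_V − tV`
# of a regime-V record (planner PLAN v4 §2 ty3: «add fields `tV` (0/1/2), `sV` := #S_V − tV (lit §35
# dictionary: 3^s = the bottom index) and keep `deltaV` as an alias of `sV`»)

HONEST FRAMING (cell `bsd-print-cfram`, run/shared/lean/pub/bsd-print-cfram/, verbatim in every file
of the cell): PARTITION currency only — the leaf counts when its class theorem is in the kernel BY
NAME, flag-free; Literature named facts are statement-only with cite tags, never sorried theorems;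
every imported theorem carries its printed hypotheses verbatim; numbers, not adjectives. THIS FILE IS
DATA INFRASTRUCTURE (one projection + unpacking lemmas); nothing about any elliptic curve is asserted,
no named fact, nothing booked, no mark moves (regime child V = stmt-BirchSwinnertonDyer-20700 stays OPEN).

DICTIONARY (displayed, never bound — REF R0.12 (iv) / R0.13): for a regime-V frame with V-places
`S_V` (ty2's `T₀`), lit DOSSIER §32 (e4)/§35 (h) identify the bottom index
`3^s = [Sel_𝔭^{S_V}(K,W) : Sel_𝔭^∅(K,W)]` = ty2's displayed defect `controlDefectAtThree W K 𝔭 κ T₀`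
(`X12/O11/RamifiedStrictDescentAtThreeRegimeV.lean`, p553473; exact control p551386) with `3^{#S_V − t}`,
`3^t = #coker(loc_{S_V})`, `t` = the number of members of `{W, W'}` whose generator is OFF the identity
component at the V-prime. The schema `X12/CMRamifiedRecordSchemaG.lean` (p553635) records `tV`,
`nSV = #S_V` and `deltaV = nSV − tV`; THIS FILE names the planner's field: **`VRow.sV := deltaV`**
(definitionally), with `sV = nSV − tV`, `tV ≤ 2` on every consistent record. On the displays
`X12/CMRamifiedVRegimeThree.lean` (p554378: the 20 V classes `N < 5·10⁵`) and
`X12/CMRamifiedVRegimeThreeBeyond.lean` (29 frames `N ≤ 3·10⁶`) the theorems `vRegimeThree_tV_deltaV` /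
`vRegimeThreeBeyond_tV_deltaV` read: `tV = 1`, `nSV = 2`, hence **`sV = 1` on 49/49 known V frames**
(the value law's correction is `3¹`, not `∏_{v∈S_V} c_v^{(3)} = 3²`). Whether `3^{sV}` EQUALS
`controlDefectAtThree` on a given frame is ty2's Selmer-index statement, not a record fact.

UPDATE (ty3 g4, 2026-08-27, lit census kit j284848): «49/49 known V frames» above means the 49 frames
`N ≤ 3·10⁶` recorded in PART G / G-B at that date, and stays true for them; it does NOT extend —
**`tV = 0`, `sV = 2` occurs** on 27 of the 179 further frames `N ≤ 2·10⁸` (all with `N ≥ 3 594 816`)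
recorded in `X12/CMRamifiedVRegimeThreeFar{A,B,C,D}.lean` (tally `X12/CMRamifiedRecordSchemaGTally.lean`,
reading `VRow.sV_eq_two_of`). So `s = #S_V − t ∈ {1, 2}` varies class by class and the V value law
carries it per class (`+ padicValNat 3 (controlDefectAtThree … T₀)`, displayed — never a constant).
-/

set_option autoImplicit false

namespace Summit.BirchSwinnertonDyer.Rank1Residual.X12.CMRamifiedRecords

namespace VRow

/-- **The bottom-index field `sV := #S_V − tV`** of a regime-V record — by definition the schema's
`deltaV` (planner PLAN v4 §2: `deltaV` is kept as its alias). [folklore] -/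
abbrev sV (r : VRow) : ℕ := r.deltaV

/-- `sV` is `deltaV`. [folklore] -/
theorem sV_eq_deltaV (r : VRow) : r.sV = r.deltaV := rfl

/-- On a consistent record: `sV = nSV − tV`, `tV = bitW + bitW' ≤ 2`, `nSV = 2·#V-primes`. [folklore] -/
theorem sV_spec_of_consistent {r : VRow} (h : r.consistent = true) :
    r.sV = r.nSV - r.tV ∧ r.tV = r.bitW.toNat + r.bitW'.toNat ∧ r.tV ≤ 2 ∧
      r.nSV = 2 * (vPrimesOf r.tam).length := by
  obtain ⟨h1, h2, h3, h4⟩ := tV_spec_of_consistent h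
  exact ⟨h4, h1, h2, h3⟩

/-- `tV + sV = nSV` on a consistent record (the two exponents split `#S_V`). [folklore] -/
theorem tV_add_sV_of_consistent {r : VRow} (h : r.consistent = true) : r.tV + r.sV = r.nSV := by
  obtain ⟨-, -, -, -, ht⟩ := (consistent_iff r).1 h
  simp only [tOK, Bool.and_eq_true, beq_iff_eq] at ht
  exact ht.2

/-- Reading a display row: if `tV = 1` and `nSV = 2` (one split V-prime, the primitive member OFF), then
`sV = 1`. [folklore] -/
theorem sV_eq_one_of {r : VRow} (h : r.consistent = true) (ht : r.tV = 1) (hn : r.nSV = 2) :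
    r.sV = 1 := by
  have := tV_add_sV_of_consistent h
  omega

end VRow

end Summit.BirchSwinnertonDyer.Rank1Residual.X12.CMRamifiedRecords
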